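import Literature.NumberTheory.Automorphic.LocalUnitaryGroupSimilitudeLevelRankTwo
import Literature.NumberTheory.Automorphic.UnitaryGroupFrameEmbedding
import Literature.NumberTheory.Automorphic.UnitaryGroupIsotropicLineElements
import Mathlib.RingTheory.DedekindDomain.Different
import HarnessLib

/-!
# A non-degenerate hermitian space of rank `N ≥ 2` over a CM (or any quadratic) extension is ISOTROPIC at almost every
# finite place; the anisotropic set `T` of the rank-2 letters is finite for EVERY hermitian `H`
# (O'Meara (1963), §63; Jacobowitz (1962), §7 Thm. 7.1; Platonov–Rapinchuk (1994), §5.1, §6.2)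

Topic `NumberTheory/Automorphic`; namespace `Literature.NumberTheory.Automorphic.UnitaryGroup`.  THEOREMS ONLY (no definition, no
named fact, no instance, no notation, no `sorry`).  Sequel to ★ `LocalUnitaryGroupSimilitudeLevelRankTwo` (whose rank-2 package
`exists_finset_rankTwo_levelMatching_of_finite` takes the finiteness of the anisotropic set `T` as a HYPOTHESIS and discharges it only
for DIAGONAL planes, by Hilbert reciprocity) — here `T` is proved finite for every non-degenerate hermitian `H` of any rank `N ≥ 2`, by
the local–global principle «a unimodular hermitian lattice at an unramified place is hyperbolic» (★
`exists_glInt_placeForm_eq_formCongr_antidiagonal_of_isUnramifiedIn`, [Jacobowitz1962, §7 Thm. 7.1]; `J_w ∈ GL_N(𝒪_w)` for almost all `w`,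
★ `eventually_forall_unit_placeForm_mem_glInt`).

Setting of ★ `UnitaryGroupLocalFactors`: `E/F` a quadratic extension of number fields, `c ∈ Gal(E/F)`, `c ≠ 1`, `J ∈ M_N(E)`, a finite
place `v` of `F`, `E_v = E ⊗_F F_v = Π_{w ∣ v} E_w` (`LocalRing E v`) with conjugation `c ⊗ 1` (`conjLocal E c v`), and the local Gram
matrix `J ⊗ 1 = (adelicForm E N J).map (adeleToLocal E v)`; «isotropic at `v`» = `∃ r ≠ 0, h_v(r, r) = 0` for `h_v = hermForm (c ⊗ 1) (J ⊗ 1)`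
(= `LemD1.IsIsotropic` of the standing data of [Liu2021, App. D §D.1], ★ `isIsotropic_standingData_iff_localGram`).

* §1 `exists_isotropic_localGram_of_smul_ne` — at a SPLIT place (`c • w ≠ w`) the local Gram form of ANY matrix is isotropic
  (`r = 1_w e₀`: the idempotent `1_w ∈ Π_{w'} E_{w'}` is killed by its conjugate `1_{c w}`);
  `exists_isotropic_localGram_of_placeForm` — at a NON-SPLIT place (`c • w = w`, `w` the only place above `v`) an isotropic vector of
  `J_w = placeForm J w` for `σ_w` over the field `E_w` gives an isotropic vector of `J ⊗ 1` over `E_v` (transport along `E_v = E_w`).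
* §2 **`eventually_forall_smul_eq_exists_isotropic`** — for `c ≠ 1`, `J` `c`-hermitian with `det J` a unit and `N ≥ 2`:
  `∀ᶠ v in cofinite`, `J ⊗ 1` is isotropic over `E_v` (at the unramified places with `J_w ∈ GL_N(𝒪_w)`: the integral hyperbolic basis
  `J_w = ᵗσ_w(T) Φ_N T` makes `T⁻¹ e₀` isotropic, since `(Φ_N)₀₀ = 0` for `N ≥ 2`); **`eventually_exists_isotropic`** (no side condition on `w`, §1).
* §3 (CM packaging, `F = L⁺`, `E = L`) **`finite_setOf_not_isIsotropic_standingData`** — for `H ∈ M_N(L)` hermitian with `det H ≠ 0`,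
  `N ≥ 2`: the set `T = {v ∣ ¬ LemD1.IsIsotropic (standingData L v c̄ N H …)}` is FINITE (for `N ≥ 3` it is even empty, ★
  `Liu2021.LemD1IsotropyOfPlace`; for `N = 2` and diagonal `H` this is ★ `LemD1OfPlace.finite_setOf_not_isIsotropic`); and the
  UNCONDITIONAL rank-2 package **`exists_finset_rankTwo_levelMatching`**: for every hermitian `H ∈ M₂(L)` with `det H ≠ 0` a finite
  `S₀ ⊇ T` with conjugation + class correspondence + level matching off `S₀` and conjugation + class correspondence off `T`
  (★ `exists_finset_rankTwo_levelMatching_of_finite` with its hypothesis discharged).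

Written for the cell `hodgecm-mathlib` (the `N = 2` edition of the quasi-split comparison letter T1g(N, H), F0P3a SPEC-ed1.19c §7;
director D1 s454∕s465).  HONEST LABEL: HC_CM is proved only modulo the printed citations until rung 0 closes; this file is unconditional
and proves no cell binder.

## References
* [Omeara1963] O. T. O'Meara, *Introduction to Quadratic Forms* (1963), §63 (local theory), §66 (almost all localisations are unimodular).
* [Jacobowitz1962] R. Jacobowitz, *Hermitian forms over local fields*, Amer. J. Math. 84 (1962), §7 Thm. 7.1.
* [PlatonovRapinchuk1994] V. Platonov, A. Rapinchuk, *Algebraic Groups and Number Theory* (1994), §5.1, §6.2.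
* [Liu2021] Y. Liu, Camb. J. Math. 9 (2021), App. D Lem. D.1 (4).
-/

set_option autoImplicit false

noncomputable section

open NumberField IsDedekindDomain Filter
open Literature.NumberTheory.Rogawski1990 (Corresponds)
open scoped Matrix MatrixGroups

namespace Literature.NumberTheory.Automorphic

namespace UnitaryGroup

/-! ## §1 Isotropic vectors of the local Gram matrix: split places, and transport from the one-place model -/

section Generic

variable {F E : Type} [Field F] [NumberField F] [Field E] [NumberField E] [Algebra F E]
  [Algebra.IsQuadraticExtension F E] (c : E ≃ₐ[F] E) {N : ℕ} (J : Matrix (Fin N) (Fin N) E)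

omit [Algebra.IsQuadraticExtension F E] in
/-- **At a SPLIT place every sesquilinear form on `E_vⁿ` is isotropic** (`N ≥ 1`): for `w ∣ v` with `c • w ≠ w` and ANY
`M ∈ M_N(E_v)`, the vector `r = 1_w · e₀` (`1_w` the idempotent of the factor `E_w` of `E_v = Π_{w' ∣ v} E_{w'}`) satisfies
`h(r, r) = (c ⊗ 1)(1_w) · M₀₀ · 1_w = 1_{c w} · M₀₀ · 1_w = 0`.  (At a split place `U(J)(F_v) ≅ GL_N(E_w)`: no anisotropy constraint.)
[cite: PlatonovRapinchuk1994, §6.2] -/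
theorem exists_isotropic_localGram_of_smul_ne {v : HeightOneSpectrum (𝓞 F)} (w : PlacesOver E v) (hw : c • w.1 ≠ w.1)
    (hN : 1 ≤ N) (M : Matrix (Fin N) (Fin N) (LocalRing E v)) :
    ∃ r : Fin N → LocalRing E v, r ≠ 0 ∧ hermForm (conjLocal E c v) M r r = 0 := by
  classical
  -- the idempotent `ε = 1_w` and `r = ε • e₀`
  let i₀ : Fin N := ⟨0, hN⟩
  set ε : LocalRing E v := Pi.single w 1 with hε_def
  set r : Fin N → LocalRing E v := Pi.single i₀ ε with hr_def
  have hne : (⟨c⁻¹ • w.1, under_inv_smul_eq c w⟩ : PlacesOver E v) ≠ w := by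
    intro h
    have h1 : c⁻¹ • w.1 = w.1 := congrArg Subtype.val h
    exact hw (by rw [inv_smul_eq_iff] at h1; exact h1.symm)
  have hε : conjLocal E c v ε * ε = 0 := by
    funext w'
    rw [Pi.mul_apply, Pi.zero_apply, conjLocal_apply]
    by_cases h : w' = w
    · subst h
      rw [show ε ⟨c⁻¹ • w'.1, under_inv_smul_eq c w'⟩ = 0 from Pi.single_eq_of_ne hne 1, map_zero, zero_mul]
    · rw [show ε w' = 0 from Pi.single_eq_of_ne h 1, mul_zero]
  have hσr : (⇑(conjLocal E c v) ∘ r) = Pi.single i₀ (conjLocal E c v ε) := by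
    funext j
    by_cases hj : j = i₀
    · subst hj
      rw [Function.comp_apply, hr_def, Pi.single_eq_same, Pi.single_eq_same]
    · rw [Function.comp_apply, hr_def, Pi.single_eq_of_ne hj, Pi.single_eq_of_ne hj, map_zero]
  refine ⟨r, fun h => ?_, ?_⟩
  · have h1 : r i₀ w = 0 := by rw [h]; rfl
    rw [hr_def, Pi.single_eq_same, hε_def, Pi.single_eq_same] at h1
    exact one_ne_zero h1
  · rw [hermForm_apply, hσr, single_dotProduct]
    change conjLocal E c v ε * ((fun j => M i₀ j) ⬝ᵥ r) = 0
    rw [hr_def, dotProduct_single, ← mul_assoc, mul_comm (conjLocal E c v ε), mul_assoc, hε, mul_zero]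

/-- **Transport of an isotropic vector from the one-place model at a NON-SPLIT place**: for `w ∣ v` with `c • w = w` (so `w` is the
only place above `v` and `E_v = E_w`, ★ `PlacesOver.subsingleton_of_smul_eq`), an isotropic vector `x ≠ 0` of `J_w = placeForm J w` for
`σ_w = galAdicCompletionMap c hw` yields an isotropic vector of the local Gram matrix `J ⊗ 1` over `E_v` for `c ⊗ 1` (the vector with
`w`-component `x`; its `h_v`-value has `w`-component `h_w(x, x)`, ★ `localForm_map_eval`). [cite: PlatonovRapinchuk1994, §5.1] -/
theorem exists_isotropic_localGram_of_placeForm (hc : c ≠ 1) {v : HeightOneSpectrum (𝓞 F)} (w : PlacesOver E v)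
    (hw : c • w.1 = w.1) {x : Fin N → w.1.adicCompletion E} (hx0 : x ≠ 0)
    (hx : hermForm (galAdicCompletionMap (L := E) c hw) (placeForm J w.1) x x = 0) :
    ∃ r : Fin N → LocalRing E v, r ≠ 0 ∧
      hermForm (conjLocal E c v) ((adelicForm E N J).map (adeleToLocal E v)) r r = 0 := by
  classical
  haveI : Subsingleton (PlacesOver E v) := PlacesOver.subsingleton_of_smul_eq c hc w hw
  -- the vector `r` of `E_vⁿ` with `w`-component `x` (`w` is the only index)
  let r : Fin N → LocalRing E v := fun i =>
    Pi.single (M := fun w' : PlacesOver E v => w'.1.adicCompletion E) w (x i)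
  have hr : ∀ i, r i w = x i := fun i =>
    Pi.single_eq_same (M := fun w' : PlacesOver E v => w'.1.adicCompletion E) w (x i)
  -- the twisted component `((c ⊗ 1) r_i)_w = σ_w (x_i)`: the place `c⁻¹ • w` IS `w`, and the proof inside `galAdicCompletionMap` is irrelevant
  have key : ∀ (w₁ : PlacesOver E v) (h₁ : c • w₁.1 = w.1) (i : Fin N),
      galAdicCompletionMap (L := E) c h₁ (r i w₁) = galAdicCompletionMap (L := E) c hw (x i) := by
    intro w₁ h₁ i
    obtain rfl : w₁ = w := Subsingleton.elim w₁ w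
    rw [hr i]
  obtain ⟨i, hi⟩ : ∃ i, x i ≠ 0 := by
    by_contra h
    push Not at h
    exact hx0 (funext h)
  refine ⟨r, fun h => hi (by rw [← hr i, h]; rfl), ?_⟩
  -- compare `w`-components through the evaluation ring homomorphism `E_v → E_w`
  let φ : LocalRing E v →+* w.1.adicCompletion E := Pi.evalRingHom (fun w' : PlacesOver E v => w'.1.adicCompletion E) w
  have h1 : (⇑φ ∘ (⇑(conjLocal E c v) ∘ r)) = ⇑(galAdicCompletionMap (L := E) c hw) ∘ x := by
    funext i
    change (conjLocal E c v (r i)) w = galAdicCompletionMap (L := E) c hw (x i)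
    rw [conjLocal_apply]
    exact key ⟨c⁻¹ • w.1, under_inv_smul_eq c w⟩ (smul_inv_smul c w.1) i
  have h2 : (⇑φ ∘ (((adelicForm E N J).map (adeleToLocal E v)) *ᵥ r)) = placeForm J w.1 *ᵥ x := by
    funext k
    rw [Function.comp_apply, RingHom.map_mulVec, localForm_map_eval]
    exact congrArg (fun y : Fin N → w.1.adicCompletion E => (placeForm J w.1 *ᵥ y) k) (funext fun i => hr i)
  have hval : φ (hermForm (conjLocal E c v) ((adelicForm E N J).map (adeleToLocal E v)) r r) = 0 := by
    rw [hermForm_apply, RingHom.map_dotProduct, h1, h2, ← hermForm_apply, hx]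
  rw [LocalRing.eq_iff_apply_eq c hc w hw, Pi.zero_apply]
  exact hval

/-! ## §2 Almost every place is isotropic -/

omit [Algebra.IsQuadraticExtension F E] in
/-- Only finitely many places of `F` ramify in `E` (prime factors of the different; private copy of the tree's
`Literature.NumberTheory.GaloisRepresentations.finite_setOf_not_isUnramifiedIn`, kept local to avoid the `L`-function imports). [folklore] -/
private theorem finite_setOf_not_isUnramifiedIn_local' :
    {v : HeightOneSpectrum (𝓞 F) | ¬ Algebra.IsUnramifiedIn (𝓞 E) v.asIdeal}.Finite := by
  have hD : differentIdeal (𝓞 F) (𝓞 E) ≠ ⊥ := differentIdeal_ne_bot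
  have hfin : {Q : HeightOneSpectrum (𝓞 E) | Q.asIdeal ∣ differentIdeal (𝓞 F) (𝓞 E)}.Finite := Ideal.finite_factors hD
  refine (hfin.image fun Q => Q.under (𝓞 F)).subset ?_
  intro q hq
  simp only [Set.mem_setOf_eq, Algebra.IsUnramifiedIn, not_forall] at hq
  obtain ⟨Q, hQprime, hQover, hQunr⟩ := hq
  haveI := hQprime
  have hQne : Q ≠ ⊥ := Ideal.ne_bot_of_liesOver_of_ne_bot q.ne_bot Q
  refine ⟨⟨Q, hQprime, hQne⟩, ?_, ?_⟩
  · exact dvd_differentIdeal_iff.mpr hQunr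
  · exact HeightOneSpectrum.ext hQover.over.symm

/-- **A non-degenerate hermitian space of rank `N ≥ 2` is isotropic at almost every non-split place** ([Omeara1963, §63, §66];
[Jacobowitz1962, §7 Thm. 7.1]): for `c ≠ 1`, `J` `c`-hermitian with `det J` a unit and `2 ≤ N`, for all but finitely many finite places
`v` of `F` and every `w ∣ v` with `c • w = w` the local Gram form `J ⊗ 1` has an isotropic vector over `E_v`.  At a place `v` UNRAMIFIED
in `E` with `J_w ∈ GL_N(𝒪_w)` (almost all `v`: ★ `eventually_forall_unit_placeForm_mem_glInt`, the different) the integral hyperbolic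
basis ★ `exists_glInt_placeForm_eq_formCongr_antidiagonal_of_isUnramifiedIn` writes `J_w = ᵗσ_w(T) · Φ_N · T`, and `T⁻¹ e₀` is isotropic
because `(Φ_N)₀₀ = 0` for `N ≥ 2`; then §1 transports it to `E_v`. [cite: Jacobowitz1962, §7 Thm. 7.1] [cite: Omeara1963, §66] -/
theorem eventually_forall_smul_eq_exists_isotropic (hc : c ≠ 1) (hJh : (J.map c)ᵀ = J) (hJ : IsUnit J.det) (hN : 2 ≤ N) :
    ∀ᶠ v : HeightOneSpectrum (𝓞 F) in cofinite, ∀ w : PlacesOver E v, c • w.1 = w.1 →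
      ∃ r : Fin N → LocalRing E v, r ≠ 0 ∧
        hermForm (conjLocal E c v) ((adelicForm E N J).map (adeleToLocal E v)) r r = 0 := by
  classical
  have hJu : IsUnit J := (Matrix.isUnit_iff_isUnit_det J).2 hJ
  filter_upwards [eventually_forall_unit_placeForm_mem_glInt (F := F) N J hJu,
    (finite_setOf_not_isUnramifiedIn_local' (F := F) (E := E)).compl_mem_cofinite] with v hint hunr w hw
  have hv : Algebra.IsUnramifiedIn (𝓞 E) v.asIdeal := not_not.1 hunr
  obtain ⟨T, -, hJT⟩ := exists_glInt_placeForm_eq_formCongr_antidiagonal_of_isUnramifiedIn F E c hc N J hJh v w hw hv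
    (isUnit_placeForm J hJu w.1) (hint w)
  -- the isotropic vector `x = T⁻¹ e₀` of `J_w`
  obtain ⟨i₀, hi₀⟩ : ∃ i₀ : Fin N, i₀.val = 0 := ⟨⟨0, by omega⟩, rfl⟩
  set e₀ : Fin N → w.1.adicCompletion E := Pi.single i₀ 1 with he₀
  set x : Fin N → w.1.adicCompletion E :=
    ((T⁻¹ : GL (Fin N) (w.1.adicCompletion E)) : Matrix (Fin N) (Fin N) (w.1.adicCompletion E)) *ᵥ e₀ with hx_def
  have hTx : ((T : GL (Fin N) (w.1.adicCompletion E)) : Matrix (Fin N) (Fin N) (w.1.adicCompletion E)) *ᵥ x = e₀ := by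
    rw [hx_def, Matrix.mulVec_mulVec, ← Units.val_mul, mul_inv_cancel, Units.val_one, Matrix.one_mulVec]
  have hx0 : x ≠ 0 := by
    intro h
    have h1 : e₀ i₀ = 0 := by rw [← hTx, h, Matrix.mulVec_zero]; rfl
    rw [he₀, Pi.single_eq_same] at h1
    exact one_ne_zero h1
  have hx : hermForm (galAdicCompletionMap (L := E) c hw) (placeForm J w.1) x x = 0 := by
    rw [hJT, ← hermForm_mulVec_mulVec_eq_hermForm_formCongr, hTx, he₀, ← antidiagOne_eq_over, hermForm_single_single,
      Matrix.of_apply, hi₀]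
    exact if_neg (by omega)
  exact exists_isotropic_localGram_of_placeForm c J hc w hw hx0 hx

/-- **… hence isotropic at almost every place** (split places are free, §1): for `c ≠ 1`, `J` `c`-hermitian with `det J` a unit and
`2 ≤ N`, `∀ᶠ v in cofinite, ∃ r ≠ 0, h_v(r, r) = 0` on `E_vⁿ`. [cite: Omeara1963, §66] [cite: PlatonovRapinchuk1994, §6.2] -/
theorem eventually_exists_isotropic (hc : c ≠ 1) (hJh : (J.map c)ᵀ = J) (hJ : IsUnit J.det) (hN : 2 ≤ N) :
    ∀ᶠ v : HeightOneSpectrum (𝓞 F) in cofinite,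
      ∃ r : Fin N → LocalRing E v, r ≠ 0 ∧
        hermForm (conjLocal E c v) ((adelicForm E N J).map (adeleToLocal E v)) r r = 0 := by
  filter_upwards [eventually_forall_smul_eq_exists_isotropic c J hc hJh hJ hN] with v hv
  obtain ⟨w⟩ : Nonempty (PlacesOver E v) := inferInstance
  by_cases hw : c • w.1 = w.1
  · exact hv w hw
  · exact exists_isotropic_localGram_of_smul_ne c w hw (by omega) _

end Generic

/-! ## §3 CM packaging: the anisotropic set `T` is finite for every hermitian `H`; the unconditional rank-2 package -/

section CM

variable (L : Type) [Field L] [NumberField L] [IsCMField L] {N : ℕ}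

/-- **The anisotropic finite places of a non-degenerate hermitian `H ∈ M_N(L)`, `N ≥ 2`, form a FINITE set** — in the currency of the
standing data of [Liu2021, App. D §D.1] at the place `v` (`¬ LemD1.IsIsotropic (standingData L v c̄ N H …)`, ★
`isIsotropic_standingData_iff_localGram`; the set `T` of the cell's rank-2 letters, ★ `RemD5CompanionParity`).  For `N ≥ 3` the set is empty
(★ `Liu2021.LemD1IsotropyOfPlace`); for `N = 2` and DIAGONAL `H` this is ★ `LemD1OfPlace.finite_setOf_not_isIsotropic` (Hilbert
reciprocity); here: any `H`, by §2. [cite: Omeara1963, §66] [cite: Liu2021, App. D Lem. D.1 (4)] -/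
theorem finite_setOf_not_isIsotropic_standingData (H : Matrix (Fin N) (Fin N) L) (hH : (H.map (cmConjRingHom L))ᵀ = H)
    (hHd : H.det ≠ 0) (hN : 2 ≤ N) {δ : L} (hcδ : IsCMField.complexConj L δ = -δ) (hδ : δ ≠ 0) :
    {v : HeightOneSpectrum (𝓞 ↥(maximalRealSubfield L)) |
      ¬ Liu2021.LemD1.IsIsotropic (Liu2021.LemD1OfPlace.standingData L v (IsCMField.complexConj L) N H hcδ hδ hN
        ((map_cmConjRingHom_eq_map_complexConj L H) ▸ hH) hHd)}.Finite := by
  have hev := eventually_exists_isotropic (IsCMField.complexConj L) H (IsCMField.complexConj_ne_one L)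
    ((map_cmConjRingHom_eq_map_complexConj L H) ▸ hH) (isUnit_iff_ne_zero.2 hHd) hN
  rw [Filter.eventually_cofinite] at hev
  refine hev.subset fun v hv => ?_
  rw [Set.mem_setOf_eq] at hv ⊢
  rwa [isIsotropic_standingData_iff_localGram] at hv

/-- … so the anisotropic places lie in a `Finset` (the form in which the rank-2 letter binds `S₀ ⊇ T`). [cite: Omeara1963, §66] -/
theorem exists_finset_not_isIsotropic_standingData_subset (H : Matrix (Fin N) (Fin N) L) (hH : (H.map (cmConjRingHom L))ᵀ = H)
    (hHd : H.det ≠ 0) (hN : 2 ≤ N) {δ : L} (hcδ : IsCMField.complexConj L δ = -δ) (hδ : δ ≠ 0) :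
    ∃ T₀ : Finset (HeightOneSpectrum (𝓞 ↥(maximalRealSubfield L))), ∀ v,
      ¬ Liu2021.LemD1.IsIsotropic (Liu2021.LemD1OfPlace.standingData L v (IsCMField.complexConj L) N H hcδ hδ hN
        ((map_cmConjRingHom_eq_map_complexConj L H) ▸ hH) hHd) → v ∈ T₀ := by
  classical
  refine ⟨(finite_setOf_not_isIsotropic_standingData L H hH hHd hN hcδ hδ).toFinset, fun v hv => ?_⟩
  rw [Set.Finite.mem_toFinset]
  exact hv

/-- **(Ψ₂) UNCONDITIONAL — the rank-2 letter T1g(2, H) (i) with the exceptional set as an output `S₀ ⊇ T`, for EVERY hermitian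
`H ∈ M₂(L)` with `det H ≠ 0`** ([Rogawski1990, §14.2 pp. 232–233] read in rank 2; [PlatonovRapinchuk1994, §5.1]): there is a finite `S₀`
containing the (finite, by `finite_setOf_not_isIsotropic_standingData`) anisotropic set `T` such that (a) for every `v ∉ S₀` some
`ψ_v : U(H)(L⁺_v) ≃ₜ* U(Φ₂)(L⁺_v)` is conjugation by an `S_v ∈ GL₂(L ⊗ L⁺_v)`, satisfies `γ′ ↔ ψ_v γ′`, `ψ_v⁻¹ γ ↔ γ` and matches the levels;
(b) for every `v ∉ T` some `e_v` is conjugation `g ↦ T_v⁻¹ g T_v` with `γ′ ↔ e_v γ′`, `e_v⁻¹ γ ↔ γ`.  = ★ `exists_finset_rankTwo_levelMatching_of_finite`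
with its finiteness hypothesis discharged. [cite: Rogawski1990, §14.2 p. 233] [cite: PlatonovRapinchuk1994, §5.1] -/
theorem exists_finset_rankTwo_levelMatching (H : Matrix (Fin 2) (Fin 2) L)
    (hH : (H.map (cmConjRingHom L))ᵀ = H) (hHd : H.det ≠ 0) {δ : L} (hcδ : IsCMField.complexConj L δ = -δ) (hδ : δ ≠ 0) :
    ∃ S₀ : Finset (HeightOneSpectrum (𝓞 ↥(maximalRealSubfield L))),
      {v : HeightOneSpectrum (𝓞 ↥(maximalRealSubfield L)) |
        ¬ Liu2021.LemD1.IsIsotropic (Liu2021.LemD1OfPlace.standingData L v (IsCMField.complexConj L) 2 H hcδ hδ le_rfl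
          ((map_cmConjRingHom_eq_map_complexConj L H) ▸ hH) hHd)} ⊆ ↑S₀ ∧
      (∀ v ∉ S₀, ∃ ψ : (cmDatum L 2 H).Local v ≃ₜ*
          (cmDatum L 2 (Matrix.of fun i j : Fin 2 => if i.val + j.val + 1 = 2 then (1 : L) else 0)).Local v,
        (∃ S : GL (Fin 2) (LocalRing L v), ∀ g : (cmDatum L 2 H).Local v,
          ((ψ g).val : GL (Fin 2) (LocalRing L v)) = S⁻¹ * g.val * S) ∧
        (∀ γ' : (cmDatum L 2 H).Local v,
          Corresponds (conjLocal L (IsCMField.complexConj L) v) ((adelicForm L 2 H).map (adeleToLocal L v))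
            ((adelicForm L 2 (Matrix.of fun i j : Fin 2 => if i.val + j.val + 1 = 2 then (1 : L) else 0)).map (adeleToLocal L v))
            γ' (ψ γ')) ∧
        (∀ γ : (cmDatum L 2 (Matrix.of fun i j : Fin 2 => if i.val + j.val + 1 = 2 then (1 : L) else 0)).Local v,
          Corresponds (conjLocal L (IsCMField.complexConj L) v) ((adelicForm L 2 H).map (adeleToLocal L v))
            ((adelicForm L 2 (Matrix.of fun i j : Fin 2 => if i.val + j.val + 1 = 2 then (1 : L) else 0)).map (adeleToLocal L v))
            (ψ.symm γ) γ) ∧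
        ∀ g, ψ g ∈ cmLocalIntegralLevel L 2 (Matrix.of fun i j : Fin 2 => if i.val + j.val + 1 = 2 then (1 : L) else 0) v ↔
          g ∈ cmLocalIntegralLevel L 2 H v) ∧
      ∀ v, Liu2021.LemD1.IsIsotropic (Liu2021.LemD1OfPlace.standingData L v (IsCMField.complexConj L) 2 H hcδ hδ le_rfl
          ((map_cmConjRingHom_eq_map_complexConj L H) ▸ hH) hHd) →
        ∃ (T : GL (Fin 2) (LocalRing L v)) (e : (cmDatum L 2 H).Local v ≃ₜ*
            (cmDatum L 2 (Matrix.of fun i j : Fin 2 => if i.val + j.val + 1 = 2 then (1 : L) else 0)).Local v),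
          (∀ g : (cmDatum L 2 H).Local v, ((e g).val : GL (Fin 2) (LocalRing L v)) = T⁻¹ * g.val * T) ∧
          (∀ γ' : (cmDatum L 2 H).Local v,
            Corresponds (conjLocal L (IsCMField.complexConj L) v) ((adelicForm L 2 H).map (adeleToLocal L v))
              ((adelicForm L 2 (Matrix.of fun i j : Fin 2 => if i.val + j.val + 1 = 2 then (1 : L) else 0)).map (adeleToLocal L v))
              γ' (e γ')) ∧
          ∀ γ : (cmDatum L 2 (Matrix.of fun i j : Fin 2 => if i.val + j.val + 1 = 2 then (1 : L) else 0)).Local v,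
            Corresponds (conjLocal L (IsCMField.complexConj L) v) ((adelicForm L 2 H).map (adeleToLocal L v))
              ((adelicForm L 2 (Matrix.of fun i j : Fin 2 => if i.val + j.val + 1 = 2 then (1 : L) else 0)).map (adeleToLocal L v))
              (e.symm γ) γ :=
  exists_finset_rankTwo_levelMatching_of_finite L H hH hHd hcδ hδ
    (finite_setOf_not_isIsotropic_standingData L H hH hHd le_rfl hcδ hδ)

end CM

end UnitaryGroup

end Literature.NumberTheory.Automorphic

end
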